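import Summits.NavierStokesRegularity.NavierStokesRegularity.Theorems.ExtremiserTransienceDissipationLedgerDefs
import Summits.NavierStokesRegularity.NavierStokesRegularity.Theorems.ExtremiserTransienceKStarAttainedHalfSpaceVariation
import HarnessLib

/-!
# LINE g10-α «dissipation ledger» (crux 26567): the HEART C1 `NearExtremiserUbiquity` — text of record

Texts of record, VERBATIM from `Cruxes/NearExtremalTransiencePerFlow/Lines/dissipation_ledger.lean` (planner ns-idea-5 g10; `E3` spelled
out): the line's one static heart C1 `NearExtremiserUbiquity` (registered stub `stub_nearExtremiserUbiquity`), omitted from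
`ExtremiserTransienceDissipationLedgerDefs.lean` (which carries the non-heart vocabulary) and needed to state the line's composition
`nearExtremalTransiencePerFlow_of_nearExtremiserUbiquity : NearExtremiserUbiquity → NearExtremalTransiencePerFlow` in `Theorems/`.
Port by prover seat ns-net-p2 (g10).  HONEST FRAMING: a definition only (an OPEN statement); nothing is proved here; no summit is proved
by a line.
-/

noncomputable section

open scoped Topology InnerProductSpace RealInnerProductSpace ENNReal ContDiff
open MeasureTheory Filter Set Metric Function
open Literature.Analysis Literature.Analysis.FluidPDE
open Summit.NavierStokesRegularity.NavierStokesRegularity.Theorems.DepletionLadder.KStar.HalfSpace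

namespace Summit.NavierStokesRegularity.NavierStokesRegularity.Theorems

set_option linter.dupNamespace false

namespace NearExtremalTransiencePerFlow.DissipationLedger

/-- (C1 — THE STATIC HEART, XL) NEAR-EXTREMISERS WITH LINEAR GROWTH CONTAIN RADIALLY UBIQUITOUS CHAINS: for all derivative bounds `Λ`,
Taylor constant `Θ` and growth constant `A` there is a thickness `g > 0` such that for every length `d` some deficit `ε > 0` suffices:
every smooth divergence-free height-`1` field with `‖D^k v‖ ≤ Λ k`, finite `Ḣ¹, Ḣ²` budgets, `0 < √Z√P`, efficiency
`(κ⋆ - ε)√Z√P ≤ |J(v)|` at height `1`, Taylor bound `Z ≤ Θ P` and linear growth `∫_{B(x,R)}‖v‖² ≤ A R` has a centre `y` such that the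
half-height set `{‖v‖ ≥ 1/2}` meets the `g`-neighbourhood of every sphere `{‖z - y‖ = r}`, `0 ≤ r ≤ d`.
Why it might fail: hierarchically dilute near-extremisers (bounded clusters at every linking scale) are not excluded by any theorem;
the line's bet (instrument: single cells `≈ 0.089–0.096`, small clusters gapped, crowds forbidden by linear growth; theory: decoupling +
`sparseAnalyticGap_holds`) is that `κ⋆ ≥ 0.1247` needs unboundedly many cells in ONE cluster, which linear growth stretches into a chain.
Sources: this seat's instrument records j320466/j321232 (HOME `inst/`), `Lines/sparse_bangbang.lean` (S-E/S-B), `Lines/filament_gap.lean` (F2 ⇒ C1). -/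
def NearExtremiserUbiquity : Prop :=
  ∀ (Λ : ℕ → ℝ) (Θ A : ℝ), ∃ g : ℝ, 0 < g ∧ ∀ d : ℝ, ∃ ε : ℝ, 0 < ε ∧
    ∀ (v : (EuclideanSpace ℝ (Fin 3)) → (EuclideanSpace ℝ (Fin 3))), ContDiff ℝ (⊤ : ℕ∞) v → Literature.Analysis.FluidPDE.VectorCalculus.IsDivFree v → (∀ x, ‖v x‖ ≤ 1) →
      (∀ (k : ℕ) (x : (EuclideanSpace ℝ (Fin 3))), ‖iteratedFDeriv ℝ k v x‖ ≤ Λ k) →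
      (∫⁻ x, ‖iteratedFDeriv ℝ 1 v x‖ₑ ^ 2 < ⊤) → (∫⁻ x, ‖iteratedFDeriv ℝ 2 v x‖ₑ ^ 2 < ⊤) →
      0 < Real.sqrt (∫ x, ‖curl v x‖ ^ 2) * Real.sqrt (∫ x, frobeniusNormSq (fderiv ℝ (curl v) x)) →
      (kStar - ε) * Real.sqrt (∫ x, ‖curl v x‖ ^ 2) * Real.sqrt (∫ x, frobeniusNormSq (fderiv ℝ (curl v) x)) ≤
        |∫ x, ⟪curl v x, fderiv ℝ v x (curl v x)⟫_ℝ| →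
      (∫ x, ‖curl v x‖ ^ 2) ≤ Θ * ∫ x, frobeniusNormSq (fderiv ℝ (curl v) x) →
      (∀ (x : (EuclideanSpace ℝ (Fin 3))) (R : ℝ), 0 < R → ∫ z in Metric.ball x R, ‖v z‖ ^ 2 ≤ A * R) →
      ∃ y : (EuclideanSpace ℝ (Fin 3)), ∀ r : ℝ, 0 ≤ r → r ≤ d → ∃ z : (EuclideanSpace ℝ (Fin 3)), |‖z - y‖ - r| ≤ g ∧ (1 / 2 : ℝ) ≤ ‖v z‖


end NearExtremalTransiencePerFlow.DissipationLedger

end Summit.NavierStokesRegularity.NavierStokesRegularity.Theorems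

end
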